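import Summits.QuantumFields.BalabanUV.Beta.ValueJetGeneric
import Summits.QuantumFields.BalabanUV.Beta.DiagonalContact
import Summits.QuantumFields.BalabanUV.Beta.HessKerDressedUnits

/-!
# `BalabanUV.Beta.GAN24.SlavedSummandLetterRows` — binder row G-an2-4 ∕ (CONV-C), W-slot, the (α-0) parity re-cut's (α-END-b): **THE TWO S-SLOT LETTER ROWS OF THE
# SLAVED SUMMAND** — row (ii) of leaf-01 g72's W-2 (journal l.50491), displayed as `hE₁ ∕ hE₂` in (b1) PART 4 `HalfMemberSlavedDivergenceLetters`; journal INTENT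
# [LEAF03-G66-INTENT2].  For a decaying kernel `K`, a local first-order family `F` and a block-window diagonal family `g`, the coarse family
# `E(p) := e3OfK N K (κ u ↦ c₀ • (F κ u ∘ diagK (g p) − diagK (g p) ∘ F κ u))` — the S-slot map of the COMMUTATOR of `F` with the gauge generator at the block of `p` —
# is localised BOTH at the passive reading (`p` fixed, slot running) AND at the active reading, with constants that are functions of the decay data only.

NOT IN PRINT; OUR BOOKKEEPING (G-an2-4 crux team (2), leaf prover `b2b-balaban-gan24-formalise-leaf-03`, gen 66).  [folklore] kernel bookkeeping BY NAME over an5's `e3OfK`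
(`ValueJetGeneric`: the sandwich route of `locStencil_e3OfK` — an4's `vertexFamily_vertexOfK`, `biLoc_comp_decays ∕ biLoc_comp_right ∕ biLoc_mmRead` — with ONE extra
factor: the block prefactor of the commutator), an4's `DiagonalContact.comp_diagK_right ∕ _left`, asym1's `HessKerDressedUnits.unitS`.  Generic `d`, generic blocking `N ≥ 1`;
0 `def`, 0 cited facts, 0 `def … : Prop`, 0 sorry.
HONEST FRAMING (cell contract, verbatim): «discharging `BetaPertH` makes Bałaban's UV stability UNCONDITIONAL — a real constructive-QFT result; it is NOT the continuum
limit and NOT the Clay problem.»  HONEST DEPENDENCY (verbatim): «continuum YM on T⁴ ⇐ BetaPertH ∧ nine spine estimates (0/9 proved); BetaPertH ⇐ (D1) ∧ (D4) ∧ CAP+tail;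
G-an2-4 gates asym, D1 and NE2/3/4.»

## What
* §1 `biLoc_commFactor` — **THE COMMUTATOR WITH A BLOCK-SUPPORTED DIAGONAL IS BI-LOCALISED WITH A BLOCK PREFACTOR**: `BiLoc V c c Cv m` (`0 ≤ m`), `|g z b| ≤ cg`, `g z b = 0`
  unless `|z − q|₁ ≤ W` ⟹ the kernel `(x z a b) ↦ c₀·(g z b − g x a)·V x z a b` is `BiLoc` at `(c, c)` with constant `2|c₀|·cg·Cv·e^{(m∕2)W}·e^{−(m∕2)|q − c|₁}`, rate `m∕2`.
* §2 `vertexOfK_commFactor` — **THE CHAIN-RULE VERTEX PASSES A FIXED DIAGONAL**: if `G κ u x z a b = c₀·(g z b − g x a)·F κ u x z a b` pointwise, then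
  `vertexOfK K N G μ y x z a b = c₀·(g z b − g x a)·vertexOfK K N F μ y x z a b` (`tsum_mul_left ∕ Finset.mul_sum`; NO summability needed); `commFactor_of_comp_diagK` — the
  hypothesis for `G κ u := c₀ • (F κ u ∘ diagK g − diagK g ∘ F κ u)`; `commFactor_of_unitS_comp_diagK` — and for `G κ u := σ • unitS sf sm (κ u ↦ c • (S κ u ∘ diagK g − diagK g ∘ S κ u)) κ u`
  with `F := unitS sf sm S`, `c₀ = σ·c` (the (b1) spelling).
* §3 **`abs_e3OfK_commFactor_le`** — THE TWO-CENTRE BOUND: `Decays K CK δK`, `LocStencil F CF δF`, `1 ≤ N`, `G_p` as in §2 with `g := g p` supported in `|z − N • p|₁ ≤ W`, `|g| ≤ cg`: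
  `|e3OfK N K G_p κ′ u′ x′ z′ a b| ≤ CE · e^{−(m∕2)|p − u′|₁} · e^{−(m∕8)(|x′ − u′|₁ + |z′ − u′|₁)}`, `m = min δF δK ∕ 2`, `CE` explicit in `(d, CK, CF, |c₀|, cg, W, m)`; hence
  **`letterRow_passive_e3OfK_commFactor`** (`LocStencil₂ (fun _ p κ′ u′ ↦ E(p) κ′ u′) CE (m∕8)` — leaf-02's three-way rate split) and **`letterRow_active_e3OfK_commFactor`**
  (`LocStencil₂ (fun κ u _ p ↦ E(p) κ u) CE (m∕8)`), both for any family `p ↦ G_p` satisfying §2's pointwise hypothesis — the rows `hE₁ ∕ hE₂` of (b1) PART 4 up to its outer scalar.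
The S-slot row `LocStencil F CF δF` and `Decays K CK δK` are HYPOTHESES (at the literal: the unit first-order table `unitS_l (SpureRecAt … l)` and the dressed unit step kernel `K♮ᴱ_l`,
whose level-free rows are the D1 END's ∕ road P1's currency); asserts NO value of any table of Bałaban's; discharges NOTHING of (Q-L) ∕ (Q-S) ∕ (Q-R) ∕ (C) ∕ «T2Shape» ∕ (hW, hWall);
(β) of record untouched; NEVER «G-an2-4 closed» as (CONV-C); NOT D1, NOT `BetaPertH`, NOT continuum, NOT Clay; not in print — our bookkeeping.
Unit `b2b-balaban-gan24-formalise-leaf-03` (gen 66), 2026-08-23.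
-/

noncomputable section

open Finset
open scoped BigOperators
open Literature.MathematicalPhysics.QuantumFieldTheory
open Literature.MathematicalPhysics.QuantumFieldTheory.Balaban1983to89
open Literature.MathematicalPhysics.QuantumFieldTheory.Balaban1983to89.Beta
open B12Sec2to5 (l1 l1_nonneg)
open ExpKernelCalculus (MKer Site Decays BiLoc VertexFamily comp Zl Zl_nonneg l1_sub_triangle l1_sub_symm l1_natSmul biLoc_comp_decays)
open OneStepResolventKernel (Fib LocStencil wsum decays_mono biLoc_mono)
open OneStepKernelFamily (vertexOfK colH vertexFamily_vertexOfK)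
open BalabanStepJetsSucc (mmRead biLoc_comp_right biLoc_mmRead)
open BalabanCompositeJets (LocStencil₂)
open Summit.QuantumFields.BalabanUV.Beta.BorderedHessian (diagK comp_diagK_right comp_diagK_left)
open Summit.QuantumFields.BalabanUV.Beta.HessKerDressedUnits (unitS unitS_apply counitK_apply legScale)
open Summit.QuantumFields.BalabanUV.Beta.SpineRooted (e3OfK e3OfK_apply)

namespace Summit.QuantumFields.BalabanUV.Beta.GAN24.SlavedSummandLetterRows

variable {d : ℕ}

/-! ## §1 The commutator with a block-supported diagonal: bi-localisation with a block prefactor -/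

/-- [folklore] **ONE SUPPORTED LEG GIVES THE BLOCK PREFACTOR**: if `|z − q|₁ ≤ W` then `e^{−m(|x−c|₁+|z−c|₁)} ≤ e^{(m∕2)W}·e^{−(m∕2)|q−c|₁}·e^{−(m∕2)(|x−c|₁+|z−c|₁)}` (`0 ≤ m`). -/
theorem exp_legs_le_of_window {m W : ℝ} (hm : 0 ≤ m) {x z q c : Site (d + 1)} (hz : l1 (z - q) ≤ W) :
    Real.exp (-m * (l1 (x - c) + l1 (z - c)))
      ≤ Real.exp (m / 2 * W) * Real.exp (-(m / 2) * l1 (q - c)) * Real.exp (-(m / 2) * (l1 (x - c) + l1 (z - c))) := by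
  rw [← Real.exp_add, ← Real.exp_add]
  apply Real.exp_le_exp.2
  have t : l1 (q - c) ≤ l1 (q - z) + l1 (z - c) := l1_sub_triangle q z c
  rw [l1_sub_symm q z] at t
  have hx := l1_nonneg (x - c)
  have hzc := l1_nonneg (z - c)
  nlinarith

/-- NOT IN PRINT; OUR BOOKKEEPING.  **THE COMMUTATOR WITH A BLOCK-SUPPORTED DIAGONAL IS BI-LOCALISED WITH A BLOCK PREFACTOR**: if `BiLoc V c c Cv m` (`0 ≤ m`), `|g z b| ≤ cg`
and `g z b = 0` unless `|z − q|₁ ≤ W`, then the kernel `c₀·(g z b − g x a)·V x z a b` (the entries of `c₀ • (V ∘ diagK g − diagK g ∘ V)`) is bi-localised at `(c, c)` with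
constant `2|c₀|·cg·Cv·e^{(m∕2)W}·e^{−(m∕2)|q − c|₁}` at rate `m∕2` — far from the block of `q` the commutator is exponentially small. -/
theorem biLoc_commFactor {V : MKer (d + 1) (Fib d)} {c q : Site (d + 1)} {Cv m : ℝ} (hV : BiLoc V c c Cv m) (hm : 0 ≤ m)
    {g : Site (d + 1) → Fib d → ℝ} {cg W : ℝ} (hgB : ∀ z b, |g z b| ≤ cg) (hgW : ∀ z b, g z b ≠ 0 → l1 (z - q) ≤ W) (c₀ : ℝ) :
    BiLoc (fun x z a b => c₀ * (g z b - g x a) * V x z a b) c c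
      (2 * |c₀| * cg * Cv * Real.exp (m / 2 * W) * Real.exp (-(m / 2) * l1 (q - c))) (m / 2) := by
  have hCv : 0 ≤ Cv := hV.nonneg (Sum.inl 0)
  have hcg : 0 ≤ cg := (abs_nonneg _).trans (hgB 0 (Sum.inl 0))
  intro x z a b
  set P : ℝ := Real.exp (m / 2 * W) * Real.exp (-(m / 2) * l1 (q - c)) * Real.exp (-(m / 2) * (l1 (x - c) + l1 (z - c))) with hP
  have hP0 : 0 ≤ P := by positivity
  have hVb := hV x z a b
  -- each supported leg contributes at most `|c₀|·cg·Cv·P`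
  have hz : |c₀ * g z b * V x z a b| ≤ |c₀| * cg * Cv * P := by
    by_cases h0 : g z b = 0
    · rw [h0, mul_zero, zero_mul, abs_zero]; positivity
    · have hw := exp_legs_le_of_window (x := x) (c := c) hm (hgW z b h0)
      rw [abs_mul, abs_mul]
      calc |c₀| * |g z b| * |V x z a b| ≤ |c₀| * cg * (Cv * Real.exp (-m * (l1 (x - c) + l1 (z - c)))) :=
            mul_le_mul (mul_le_mul_of_nonneg_left (hgB z b) (abs_nonneg _)) hVb (abs_nonneg _) (by positivity)
        _ ≤ |c₀| * cg * (Cv * P) := mul_le_mul_of_nonneg_left (mul_le_mul_of_nonneg_left hw hCv) (by positivity)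
        _ = |c₀| * cg * Cv * P := by ring
  have hx : |c₀ * g x a * V x z a b| ≤ |c₀| * cg * Cv * P := by
    by_cases h0 : g x a = 0
    · rw [h0, mul_zero, zero_mul, abs_zero]; positivity
    · have hw := exp_legs_le_of_window (x := z) (c := c) hm (hgW x a h0)
      rw [add_comm (l1 (z - c))] at hw
      rw [abs_mul, abs_mul]
      calc |c₀| * |g x a| * |V x z a b| ≤ |c₀| * cg * (Cv * Real.exp (-m * (l1 (x - c) + l1 (z - c)))) :=
            mul_le_mul (mul_le_mul_of_nonneg_left (hgB x a) (abs_nonneg _)) hVb (abs_nonneg _) (by positivity)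
        _ ≤ |c₀| * cg * (Cv * P) := mul_le_mul_of_nonneg_left (mul_le_mul_of_nonneg_left hw hCv) (by positivity)
        _ = |c₀| * cg * Cv * P := by ring
  have e : c₀ * (g z b - g x a) * V x z a b = c₀ * g z b * V x z a b - c₀ * g x a * V x z a b := by ring
  show |c₀ * (g z b - g x a) * V x z a b| ≤ _
  rw [e]
  calc |c₀ * g z b * V x z a b - c₀ * g x a * V x z a b| ≤ |c₀ * g z b * V x z a b| + |c₀ * g x a * V x z a b| := abs_sub _ _
    _ ≤ |c₀| * cg * Cv * P + |c₀| * cg * Cv * P := add_le_add hz hx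
    _ = 2 * |c₀| * cg * Cv * Real.exp (m / 2 * W) * Real.exp (-(m / 2) * l1 (q - c)) * Real.exp (-(m / 2) * (l1 (x - c) + l1 (z - c))) := by
        rw [hP]; ring

/-! ## §2 The chain-rule vertex passes a fixed diagonal -/

/-- [folklore] **THE CHAIN-RULE VERTEX PASSES A FIXED DIAGONAL FACTOR**: if `G κ u x z a b = c₀·(g z b − g x a)·F κ u x z a b` pointwise (the factor does not depend on the
slot `(κ, u)`), then `vertexOfK K N G μ y x z a b = c₀·(g z b − g x a)·vertexOfK K N F μ y x z a b` — `tsum_mul_left` inside an4's `wsum`, NO summability needed. -/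
theorem vertexOfK_commFactor {K : MKer (d + 1) (Fib d)} {N : ℕ} {F G : Fin (d + 1) → Site (d + 1) → MKer (d + 1) (Fib d)} {c₀ : ℝ}
    {g : Site (d + 1) → Fib d → ℝ} (hG : ∀ κ u x z a b, G κ u x z a b = c₀ * (g z b - g x a) * F κ u x z a b)
    (μ : Fin (d + 1)) (y x z : Site (d + 1)) (a b : Fib d) :
    vertexOfK K N G μ y x z a b = c₀ * (g z b - g x a) * vertexOfK K N F μ y x z a b := by
  simp only [vertexOfK, wsum, Finset.mul_sum]
  refine Finset.sum_congr rfl fun κ' _ => ?_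
  rw [← tsum_mul_left]
  refine tsum_congr fun u => ?_
  rw [hG]
  ring

/-- [folklore] The entries of `c₀ • (F κ u ∘ diagK g − diagK g ∘ F κ u)` have the factor form of `vertexOfK_commFactor` (an4's `comp_diagK_right ∕ _left`). -/
theorem commFactor_of_comp_diagK (F : Fin (d + 1) → Site (d + 1) → MKer (d + 1) (Fib d)) (g : Site (d + 1) → Fib d → ℝ) (c₀ : ℝ)
    (κ : Fin (d + 1)) (u x z : Site (d + 1)) (a b : Fib d) :
    (c₀ • (comp (F κ u) (diagK g) - comp (diagK g) (F κ u))) x z a b = c₀ * (g z b - g x a) * F κ u x z a b := by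
  simp only [Pi.smul_apply, Pi.sub_apply, smul_eq_mul, comp_diagK_right, comp_diagK_left]
  ring

/-- [folklore] **THE (b1) SPELLING**: the entries of `σ • unitS sf sm (κ u ↦ c • (S κ u ∘ diagK g − diagK g ∘ S κ u)) κ u` have the factor form with `F := unitS sf sm S`,
`c₀ := σ·c` — the contragredient change of units is entrywise and commutes with a diagonal (`counitK_apply`). -/
theorem commFactor_of_unitS_comp_diagK (sf sm : ℝ) (S : Fin (d + 1) → Site (d + 1) → MKer (d + 1) (Fib d)) (g : Site (d + 1) → Fib d → ℝ)
    (σ c : ℝ) (κ : Fin (d + 1)) (u x z : Site (d + 1)) (a b : Fib d) :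
    (σ • unitS sf sm (fun κ u => c • (comp (S κ u) (diagK g) - comp (diagK g) (S κ u))) κ u) x z a b
      = σ * c * (g z b - g x a) * unitS sf sm S κ u x z a b := by
  simp only [Pi.smul_apply, smul_eq_mul, unitS_apply, Pi.sub_apply, comp_diagK_right, comp_diagK_left]
  ring

/-! ## §3 The two-centre bound on `e3OfK` of the commutator family, and the two letter rows -/

section Rows

variable {K : MKer (d + 1) (Fib d)} {N : ℕ} {CK δK CF δF : ℝ} {F : Fin (d + 1) → Site (d + 1) → MKer (d + 1) (Fib d)}
  {G : Site (d + 1) → Fin (d + 1) → Site (d + 1) → MKer (d + 1) (Fib d)} {c₀ : ℝ} {g : Site (d + 1) → Site (d + 1) → Fib d → ℝ} {cg W : ℝ}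

/-- NOT IN PRINT; OUR BOOKKEEPING.  **THE TWO-CENTRE BOUND** (`1 ≤ N`, `Decays K CK δK` with `0 < δK`, `LocStencil F CF δF` with `0 < δF`, and for every block index `p`
a slot family `G p` whose entries are `c₀·(g p z b − g p x a)·F κ u x z a b` with `|g p z b| ≤ cg`, `g p z b = 0` unless `|z − N • p|₁ ≤ W`): with `m := min δF δK ∕ 2`,
`|e3OfK N K (G p) κ′ u′ x′ z′ a b| ≤ CE · e^{−(m∕2)|p − u′|₁} · e^{−(m∕8)(|x′ − u′|₁ + |z′ − u′|₁)}`,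
`CE = |Fib|·(|Fib|·(CK·C♭)·Zl(m∕4)·CK)·Zl(m∕8)`, `C♭ = 2|c₀|·cg·((d+1)·(CK·CF·Zl(m)))·e^{(m∕2)W}` — §2 ⨾ an4's `vertexFamily_vertexOfK` ⨾ §1 at `c = N • u′`, `q = N • p` ⨾ the
sandwich of `locStencil_e3OfK` ⨾ `|N • (p − u′)|₁ ≥ |p − u′|₁`. -/
theorem abs_e3OfK_commFactor_le (hN : 1 ≤ N) (hK : Decays K CK δK) (hδK : 0 < δK) (hF : LocStencil F CF δF) (hδF : 0 < δF)
    (hG : ∀ p κ u x z a b, G p κ u x z a b = c₀ * (g p z b - g p x a) * F κ u x z a b)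
    (hgB : ∀ p z b, |g p z b| ≤ cg) (hgW : ∀ p z b, g p z b ≠ 0 → l1 (z - (N : ℤ) • p) ≤ W)
    (p : Site (d + 1)) (κ' : Fin (d + 1)) (u' x' z' : Site (d + 1)) (a b : Fib d) :
    |e3OfK N K (G p) κ' u' x' z' a b|
      ≤ (Fintype.card (Fib d) : ℝ) * ((Fintype.card (Fib d) : ℝ) * (CK * (2 * |c₀| * cg * (((d + 1 : ℕ) : ℝ) * (CK * CF * Zl (d + 1) (min δF δK / 2)))
            * Real.exp (min δF δK / 2 / 2 * W))) * Zl (d + 1) (min δF δK / 2 / 2 - min δF δK / 2 / 4) * CK) * Zl (d + 1) (min δF δK / 2 / 4 - min δF δK / 2 / 8)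
        * Real.exp (-(min δF δK / 2 / 2) * l1 (p - u')) * Real.exp (-(min δF δK / 2 / 8) * (l1 (x' - u') + l1 (z' - u'))) := by
  set m : ℝ := min δF δK / 2 with hm
  have hm0 : 0 < m := by rw [hm]; exact half_pos (lt_min hδF hδK)
  have hCK : 0 ≤ CK := hK.nonneg (Sum.inl 0)
  have hCF : 0 ≤ CF := (hF 0 0).nonneg (Sum.inl 0)
  have hcg : 0 ≤ cg := (abs_nonneg _).trans (hgB 0 0 (Sum.inl 0))
  -- the plain vertex is a vertex family at rate `m` (an4); the kernel decays at every smaller rate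
  have hmin : min δF δK ≤ δK := min_le_right _ _
  have hmin' : min δF δK ≤ δF := min_le_left _ _
  have hF' : LocStencil F CF (min δF δK) := fun κ u => biLoc_mono (hF κ u) hCF hmin'
  have hV : VertexFamily (vertexOfK K N F) N (((d + 1 : ℕ) : ℝ) * (CK * CF * Zl (d + 1) (min δF δK / 2))) (min δF δK / 2) :=
    vertexFamily_vertexOfK (N := N) hK hCK hF' (lt_min hδF hδK) hmin
  have hVu : BiLoc (vertexOfK K N F κ' u') ((N : ℤ) • u') ((N : ℤ) • u') (((d + 1 : ℕ) : ℝ) * (CK * CF * Zl (d + 1) m)) m := hV κ' u'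
  -- §2: the commutator family's vertex is the factor times the plain vertex; §1: the block prefactor
  have hVg : BiLoc (vertexOfK K N (G p) κ' u') ((N : ℤ) • u') ((N : ℤ) • u')
      (2 * |c₀| * cg * (((d + 1 : ℕ) : ℝ) * (CK * CF * Zl (d + 1) m)) * Real.exp (m / 2 * W) * Real.exp (-(m / 2) * l1 ((N : ℤ) • p - (N : ℤ) • u'))) (m / 2) := by
    have h := biLoc_commFactor (q := (N : ℤ) • p) hVu hm0.le (hgB p) (hgW p) c₀
    intro x z a₁ b₁
    rw [vertexOfK_commFactor (hG p) κ' u' x z a₁ b₁]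
    exact h x z a₁ b₁
  -- the sandwich `K ∘ V ∘ K` and the `mm`-read, as in an5's `locStencil_e3OfK`
  have hKm2 : Decays K CK (m / 2) := decays_mono hK hCK le_rfl (by rw [hm]; linarith)
  have hKm4 : Decays K CK (m / 4) := decays_mono hK hCK le_rfl (by rw [hm]; linarith)
  have h1 := biLoc_comp_decays hKm2 hVg (show 0 ≤ m / 4 by positivity) (by linarith)
  have h2 := biLoc_comp_right h1 hKm4 (show 0 ≤ m / 8 by positivity) (by linarith)
  have h3 := biLoc_mmRead hN h2 (by positivity) x' z' a b
  rw [e3OfK_apply, abs_neg]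
  refine h3.trans ?_
  -- `|N • (p − u′)|₁ ≥ |p − u′|₁`
  have hNp : l1 (p - u') ≤ l1 ((N : ℤ) • p - (N : ℤ) • u') := by
    rw [← smul_sub, l1_natSmul]
    have h1N : (1 : ℝ) ≤ N := by exact_mod_cast hN
    have := l1_nonneg (p - u')
    nlinarith
  have hexp : Real.exp (-(m / 2) * l1 ((N : ℤ) • p - (N : ℤ) • u')) ≤ Real.exp (-(m / 2) * l1 (p - u')) :=
    Real.exp_le_exp.2 (by nlinarith)
  have hZ0 : 0 ≤ Zl (d + 1) m := Zl_nonneg hm0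
  have hZ1 : 0 ≤ Zl (d + 1) (m / 2 - m / 4) := Zl_nonneg (by linarith)
  have hZ2 : 0 ≤ Zl (d + 1) (m / 4 - m / 8) := Zl_nonneg (by linarith)
  have hA : 0 ≤ (Fintype.card (Fib d) : ℝ) * ((Fintype.card (Fib d) : ℝ) * (CK * (2 * |c₀| * cg * (((d + 1 : ℕ) : ℝ) * (CK * CF * Zl (d + 1) m))
      * Real.exp (m / 2 * W))) * Zl (d + 1) (m / 2 - m / 4) * CK) * Zl (d + 1) (m / 4 - m / 8) := by positivity
  have key := mul_le_mul_of_nonneg_right (mul_le_mul_of_nonneg_left hexp hA) (Real.exp_pos (-(m / 8) * (l1 (x' - u') + l1 (z' - u')))).le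
  convert key using 1
  ring

/-- NOT IN PRINT; OUR BOOKKEEPING.  **THE PASSIVE ROW (`hE₁`-type)**: under the hypotheses of `abs_e3OfK_commFactor_le`, the table `(_, p, κ′, u′) ↦ e3OfK N K (G p) κ′ u′` —
the block index `p` as the LOCALISATION site, the coarse slot running — is `LocStencil₂` at rate `m∕8` (`m = min δF δK ∕ 2`) with the SAME constant: the three-way split of
the block prefactor `e^{−(m∕2)|p − u′|₁}` recentres both legs from `u′` to `p` (leaf-02's `letter_fst_recenter` route). -/
theorem letterRow_passive_e3OfK_commFactor (hN : 1 ≤ N) (hK : Decays K CK δK) (hδK : 0 < δK) (hF : LocStencil F CF δF) (hδF : 0 < δF)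
    (hG : ∀ p κ u x z a b, G p κ u x z a b = c₀ * (g p z b - g p x a) * F κ u x z a b)
    (hgB : ∀ p z b, |g p z b| ≤ cg) (hgW : ∀ p z b, g p z b ≠ 0 → l1 (z - (N : ℤ) • p) ≤ W) :
    LocStencil₂ (fun (_ : Fin (d + 1)) (p : Site (d + 1)) (κ' : Fin (d + 1)) (u' : Site (d + 1)) => e3OfK N K (G p) κ' u')
      ((Fintype.card (Fib d) : ℝ) * ((Fintype.card (Fib d) : ℝ) * (CK * (2 * |c₀| * cg * (((d + 1 : ℕ) : ℝ) * (CK * CF * Zl (d + 1) (min δF δK / 2)))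
            * Real.exp (min δF δK / 2 / 2 * W))) * Zl (d + 1) (min δF δK / 2 / 2 - min δF δK / 2 / 4) * CK) * Zl (d + 1) (min δF δK / 2 / 4 - min δF δK / 2 / 8))
      (min δF δK / 2 / 8) := by
  have hCK : 0 ≤ CK := hK.nonneg (Sum.inl 0)
  have hCF : 0 ≤ CF := (hF 0 0).nonneg (Sum.inl 0)
  have hcg : 0 ≤ cg := (abs_nonneg _).trans (hgB 0 0 (Sum.inl 0))
  intro _ p κ' u' x' z' a b
  have h := abs_e3OfK_commFactor_le hN hK hδK hF hδF hG hgB hgW p κ' u' x' z' a b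
  set A : ℝ := (Fintype.card (Fib d) : ℝ) * ((Fintype.card (Fib d) : ℝ) * (CK * (2 * |c₀| * cg * (((d + 1 : ℕ) : ℝ) * (CK * CF * Zl (d + 1) (min δF δK / 2)))
            * Real.exp (min δF δK / 2 / 2 * W))) * Zl (d + 1) (min δF δK / 2 / 2 - min δF δK / 2 / 4) * CK) * Zl (d + 1) (min δF δK / 2 / 4 - min δF δK / 2 / 8) with hA
  set m : ℝ := min δF δK / 2 with hm
  have hm0 : 0 < m := by rw [hm]; exact half_pos (lt_min hδF hδK)
  have hA0 : 0 ≤ A := by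
    have hZ0 : 0 ≤ Zl (d + 1) m := Zl_nonneg hm0
    have hZ1 : 0 ≤ Zl (d + 1) (m / 2 - m / 4) := Zl_nonneg (by linarith)
    have hZ2 : 0 ≤ Zl (d + 1) (m / 4 - m / 8) := Zl_nonneg (by linarith)
    rw [hA]; positivity
  refine h.trans ?_
  have hE : Real.exp (-(m / 2) * l1 (p - u')) * Real.exp (-(m / 8) * (l1 (x' - u') + l1 (z' - u')))
      ≤ Real.exp (-(m / 8) * l1 (u' - p)) * Real.exp (-(m / 8) * (l1 (x' - p) + l1 (z' - p))) := by
    rw [← Real.exp_add, ← Real.exp_add]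
    refine Real.exp_le_exp.2 ?_
    have t1 : l1 (x' - p) ≤ l1 (x' - u') + l1 (u' - p) := l1_sub_triangle x' u' p
    have t2 : l1 (z' - p) ≤ l1 (z' - u') + l1 (u' - p) := l1_sub_triangle z' u' p
    rw [l1_sub_symm p u']
    have h0 := l1_nonneg (u' - p)
    nlinarith
  calc A * Real.exp (-(m / 2) * l1 (p - u')) * Real.exp (-(m / 8) * (l1 (x' - u') + l1 (z' - u')))
      = A * (Real.exp (-(m / 2) * l1 (p - u')) * Real.exp (-(m / 8) * (l1 (x' - u') + l1 (z' - u')))) := by ring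
    _ ≤ A * (Real.exp (-(m / 8) * l1 (u' - p)) * Real.exp (-(m / 8) * (l1 (x' - p) + l1 (z' - p)))) := mul_le_mul_of_nonneg_left hE hA0
    _ = A * Real.exp (-(m / 8) * l1 (u' - p)) * Real.exp (-(m / 8) * (l1 (x' - p) + l1 (z' - p))) := by ring

/-- NOT IN PRINT; OUR BOOKKEEPING.  **THE ACTIVE ROW (`hE₂`-type)**: under the same hypotheses, the table `(κ, u, _, p) ↦ e3OfK N K (G p) κ u` — the coarse slot as the
localisation site, the block index running — is `LocStencil₂` at rate `m∕8` with the SAME constant (the block prefactor IS the separation weight). -/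
theorem letterRow_active_e3OfK_commFactor (hN : 1 ≤ N) (hK : Decays K CK δK) (hδK : 0 < δK) (hF : LocStencil F CF δF) (hδF : 0 < δF)
    (hG : ∀ p κ u x z a b, G p κ u x z a b = c₀ * (g p z b - g p x a) * F κ u x z a b)
    (hgB : ∀ p z b, |g p z b| ≤ cg) (hgW : ∀ p z b, g p z b ≠ 0 → l1 (z - (N : ℤ) • p) ≤ W) :
    LocStencil₂ (fun (κ : Fin (d + 1)) (u : Site (d + 1)) (_ : Fin (d + 1)) (p : Site (d + 1)) => e3OfK N K (G p) κ u)
      ((Fintype.card (Fib d) : ℝ) * ((Fintype.card (Fib d) : ℝ) * (CK * (2 * |c₀| * cg * (((d + 1 : ℕ) : ℝ) * (CK * CF * Zl (d + 1) (min δF δK / 2)))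
            * Real.exp (min δF δK / 2 / 2 * W))) * Zl (d + 1) (min δF δK / 2 / 2 - min δF δK / 2 / 4) * CK) * Zl (d + 1) (min δF δK / 2 / 4 - min δF δK / 2 / 8))
      (min δF δK / 2 / 8) := by
  have hCK : 0 ≤ CK := hK.nonneg (Sum.inl 0)
  have hCF : 0 ≤ CF := (hF 0 0).nonneg (Sum.inl 0)
  have hcg : 0 ≤ cg := (abs_nonneg _).trans (hgB 0 0 (Sum.inl 0))
  intro κ u _ p x' z' a b
  have h := abs_e3OfK_commFactor_le hN hK hδK hF hδF hG hgB hgW p κ u x' z' a b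
  set A : ℝ := (Fintype.card (Fib d) : ℝ) * ((Fintype.card (Fib d) : ℝ) * (CK * (2 * |c₀| * cg * (((d + 1 : ℕ) : ℝ) * (CK * CF * Zl (d + 1) (min δF δK / 2)))
            * Real.exp (min δF δK / 2 / 2 * W))) * Zl (d + 1) (min δF δK / 2 / 2 - min δF δK / 2 / 4) * CK) * Zl (d + 1) (min δF δK / 2 / 4 - min δF δK / 2 / 8) with hA
  set m : ℝ := min δF δK / 2 with hm
  have hm0 : 0 < m := by rw [hm]; exact half_pos (lt_min hδF hδK)
  have hA0 : 0 ≤ A := by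
    have hZ0 : 0 ≤ Zl (d + 1) m := Zl_nonneg hm0
    have hZ1 : 0 ≤ Zl (d + 1) (m / 2 - m / 4) := Zl_nonneg (by linarith)
    have hZ2 : 0 ≤ Zl (d + 1) (m / 4 - m / 8) := Zl_nonneg (by linarith)
    rw [hA]; positivity
  refine h.trans ?_
  have hE : Real.exp (-(m / 2) * l1 (p - u)) ≤ Real.exp (-(m / 8) * l1 (p - u)) := by
    refine Real.exp_le_exp.2 ?_
    have h0 := l1_nonneg (p - u)
    nlinarith
  exact mul_le_mul_of_nonneg_right (mul_le_mul_of_nonneg_left hE hA0) (Real.exp_pos _).le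

end Rows

/-! ## §4 The (b1) instance at `ε = 1`: the rows `hE₁ ∕ hE₂` of `HalfMemberSlavedDivergenceLetters` for the EVEN member -/

section Even

variable {K : MKer (d + 1) (Fib d)} {N : ℕ} {CK δK Cs δS : ℝ} {S : Fin (d + 1) → Site (d + 1) → MKer (d + 1) (Fib d)}
  {X : Site (d + 1) → MKer (d + 1) (Fib d)} {g : Site (d + 1) → Site (d + 1) → Fib d → ℝ} {cg W : ℝ}
  {R R'' : Site (d + 1) → Fin (d + 1) → Site (d + 1) → MKer (d + 1) (Fib d)}

/-- [folklore] **AT `ε = 1` THE SLAVED LETTER TABLE IS THE PURE COMMUTATOR TABLE IN FACTOR FORM** (the residual summand carries `((1 − 1)∕2) = 0`; the commutator summand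
`((1 + 1)∕2) = 1`; then §2's `commFactor_of_unitS_comp_diagK`): with `X p = diagK (g p)`,
`((sf·sm)⁻¹ • unitS sf sm (κ u ↦ cH′⁻¹ • (((1+1)∕2) • (S κ u ∘ X p − X p ∘ S κ u) + ((1−1)∕2) • R p κ u)) κ u) x z a b = ((sf·sm)⁻¹·cH′⁻¹)·(g p z b − g p x a)·(unitS sf sm S κ u) x z a b`. -/
theorem evenLetterTable_eq_commFactor (hX : ∀ p, X p = diagK (g p)) (sf sm cH' : ℝ)
    (Rany : Site (d + 1) → Fin (d + 1) → Site (d + 1) → MKer (d + 1) (Fib d))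
    (p : Site (d + 1)) (κ : Fin (d + 1)) (u x z : Site (d + 1)) (a b : Fib d) :
    ((sf * sm)⁻¹ • unitS sf sm (fun κ u => cH'⁻¹ • ((((1 : ℝ) + 1) / 2) • (comp (S κ u) (X p) - comp (X p) (S κ u))
        + (((1 : ℝ) - 1) / 2) • Rany p κ u)) κ u) x z a b
      = (sf * sm)⁻¹ * cH'⁻¹ * (g p z b - g p x a) * unitS sf sm S κ u x z a b := by
  have e : (fun κ u => cH'⁻¹ • ((((1 : ℝ) + 1) / 2) • (comp (S κ u) (X p) - comp (X p) (S κ u)) + (((1 : ℝ) - 1) / 2) • Rany p κ u))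
      = fun κ u => cH'⁻¹ • (comp (S κ u) (diagK (g p)) - comp (diagK (g p)) (S κ u)) := by
    funext κ u
    rw [hX p]
    norm_num
  rw [e]
  exact commFactor_of_unitS_comp_diagK sf sm S (g p) (sf * sm)⁻¹ cH'⁻¹ κ u x z a b

/-- NOT IN PRINT; OUR BOOKKEEPING.  **THE ROWS `hE₁ ∕ hE₂` OF (b1) PART 4 FOR THE EVEN MEMBER** (`ε = 1`; generic `d`, blocking `N ≥ 1`, ANY decaying step kernel `K`
(`CK, δK > 0`), ANY first-order family `S` with the unit S-slot row `LocStencil (unitS sf sm S) Cs δS` (`δS > 0`), any unit scalars `sf sm`, lock constant `cH′`, outer scalar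
`cout`, gauge generators `X p = diagK (g p)` with `|g p z b| ≤ cg` supported in `|z − N • p|₁ ≤ W`, ANY residual letters `R R″` — they drop at `ε = 1`): the table
`E(p) κ′ u′ := cout • (e3OfK N K (κ′ u′ ↦ (sf·sm)⁻¹ • unitS sf sm (κ′ u′ ↦ cH′⁻¹ • (((1+1)∕2) • [S κ′ u′, X p] + ((1−1)∕2) • R p κ′ u′)) κ′ u′) κ′ u′ + (the `R″` twin) κ′ u′)`
carries BOTH rows `LocStencil₂ (fun _ p κ′ u′ ↦ E(p) κ′ u′) CE δE` and `LocStencil₂ (fun κ u _ p ↦ E(p) κ u) CE δE` with `CE = |cout|·(A + A)`, `A` = §3's constant at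
`c₀ = (sf·sm)⁻¹·cH′⁻¹`, `CF = Cs`, `δF = δS`, and `δE = min δS δK ∕ 16` — FUNCTIONS OF `(d, CK, δK, Cs, δS, sf·sm, cH′, cout, cg, W)` ONLY: level-free whenever these are.
This is leaf-01 g72 W-2's located row (ii) ∕ the refuter g59's REFUTER NOTE (C) «PIN» (P2) in letter currency, for the even member.  The S-slot row and the K decay are
HYPOTHESES (the D1 END's ∕ road P1's currency); NOTHING of (Q-L) ∕ (Q-R) ∕ (C) is touched. -/
theorem evenRows_of_Srow (hN : 1 ≤ N) (hK : Decays K CK δK) (hδK : 0 < δK) (sf sm cH' cout : ℝ) (hSu : LocStencil (unitS sf sm S) Cs δS) (hδS : 0 < δS)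
    (hX : ∀ p, X p = diagK (g p)) (hgB : ∀ p z b, |g p z b| ≤ cg) (hgW : ∀ p z b, g p z b ≠ 0 → l1 (z - (N : ℤ) • p) ≤ W) :
    LocStencil₂ (fun (_ : Fin (d + 1)) (p : Site (d + 1)) (κ' : Fin (d + 1)) (u' : Site (d + 1)) =>
        cout • (e3OfK N K (fun κ' u' => (sf * sm)⁻¹ • unitS sf sm
            (fun κ' u' => cH'⁻¹ • ((((1 : ℝ) + 1) / 2) • (comp (S κ' u') (X p) - comp (X p) (S κ' u')) + (((1 : ℝ) - 1) / 2) • R p κ' u')) κ' u') κ' u'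
          + e3OfK N K (fun κ u => (sf * sm)⁻¹ • unitS sf sm
            (fun κ u => cH'⁻¹ • ((((1 : ℝ) + 1) / 2) • (comp (S κ u) (X p) - comp (X p) (S κ u)) + (((1 : ℝ) - 1) / 2) • R'' p κ u)) κ u) κ' u'))
      (|cout| * ((Fintype.card (Fib d) : ℝ) * ((Fintype.card (Fib d) : ℝ) * (CK * (2 * |(sf * sm)⁻¹ * cH'⁻¹| * cg * (((d + 1 : ℕ) : ℝ) * (CK * Cs * Zl (d + 1) (min δS δK / 2)))
            * Real.exp (min δS δK / 2 / 2 * W))) * Zl (d + 1) (min δS δK / 2 / 2 - min δS δK / 2 / 4) * CK) * Zl (d + 1) (min δS δK / 2 / 4 - min δS δK / 2 / 8)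
        + (Fintype.card (Fib d) : ℝ) * ((Fintype.card (Fib d) : ℝ) * (CK * (2 * |(sf * sm)⁻¹ * cH'⁻¹| * cg * (((d + 1 : ℕ) : ℝ) * (CK * Cs * Zl (d + 1) (min δS δK / 2)))
            * Real.exp (min δS δK / 2 / 2 * W))) * Zl (d + 1) (min δS δK / 2 / 2 - min δS δK / 2 / 4) * CK) * Zl (d + 1) (min δS δK / 2 / 4 - min δS δK / 2 / 8)))
      (min δS δK / 2 / 8)
    ∧ LocStencil₂ (fun (κ : Fin (d + 1)) (u : Site (d + 1)) (_ : Fin (d + 1)) (p : Site (d + 1)) =>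
        cout • (e3OfK N K (fun κ' u' => (sf * sm)⁻¹ • unitS sf sm
            (fun κ' u' => cH'⁻¹ • ((((1 : ℝ) + 1) / 2) • (comp (S κ' u') (X p) - comp (X p) (S κ' u')) + (((1 : ℝ) - 1) / 2) • R p κ' u')) κ' u') κ u
          + e3OfK N K (fun κ u => (sf * sm)⁻¹ • unitS sf sm
            (fun κ u => cH'⁻¹ • ((((1 : ℝ) + 1) / 2) • (comp (S κ u) (X p) - comp (X p) (S κ u)) + (((1 : ℝ) - 1) / 2) • R'' p κ u)) κ u) κ u))
      (|cout| * ((Fintype.card (Fib d) : ℝ) * ((Fintype.card (Fib d) : ℝ) * (CK * (2 * |(sf * sm)⁻¹ * cH'⁻¹| * cg * (((d + 1 : ℕ) : ℝ) * (CK * Cs * Zl (d + 1) (min δS δK / 2)))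
            * Real.exp (min δS δK / 2 / 2 * W))) * Zl (d + 1) (min δS δK / 2 / 2 - min δS δK / 2 / 4) * CK) * Zl (d + 1) (min δS δK / 2 / 4 - min δS δK / 2 / 8)
        + (Fintype.card (Fib d) : ℝ) * ((Fintype.card (Fib d) : ℝ) * (CK * (2 * |(sf * sm)⁻¹ * cH'⁻¹| * cg * (((d + 1 : ℕ) : ℝ) * (CK * Cs * Zl (d + 1) (min δS δK / 2)))
            * Real.exp (min δS δK / 2 / 2 * W))) * Zl (d + 1) (min δS δK / 2 / 2 - min δS δK / 2 / 4) * CK) * Zl (d + 1) (min δS δK / 2 / 4 - min δS δK / 2 / 8)))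
      (min δS δK / 2 / 8) := by
  -- both inner tables are the SAME commutator table in factor form (§2 ∕ `evenLetterTable_eq_commFactor`)
  have hG : ∀ p κ u x z a b, ((sf * sm)⁻¹ • unitS sf sm (fun κ u => cH'⁻¹ • ((((1 : ℝ) + 1) / 2) • (comp (S κ u) (X p) - comp (X p) (S κ u))
      + (((1 : ℝ) - 1) / 2) • R p κ u)) κ u) x z a b = (sf * sm)⁻¹ * cH'⁻¹ * (g p z b - g p x a) * unitS sf sm S κ u x z a b :=
    fun p κ u x z a b => evenLetterTable_eq_commFactor hX sf sm cH' R p κ u x z a b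
  have hG'' : ∀ p κ u x z a b, ((sf * sm)⁻¹ • unitS sf sm (fun κ u => cH'⁻¹ • ((((1 : ℝ) + 1) / 2) • (comp (S κ u) (X p) - comp (X p) (S κ u))
      + (((1 : ℝ) - 1) / 2) • R'' p κ u)) κ u) x z a b = (sf * sm)⁻¹ * cH'⁻¹ * (g p z b - g p x a) * unitS sf sm S κ u x z a b :=
    fun p κ u x z a b => evenLetterTable_eq_commFactor hX sf sm cH' R'' p κ u x z a b
  have hP := letterRow_passive_e3OfK_commFactor (G := fun p κ u => (sf * sm)⁻¹ • unitS sf sm (fun κ u => cH'⁻¹ • ((((1 : ℝ) + 1) / 2) •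
      (comp (S κ u) (X p) - comp (X p) (S κ u)) + (((1 : ℝ) - 1) / 2) • R p κ u)) κ u) hN hK hδK hSu hδS hG hgB hgW
  have hP'' := letterRow_passive_e3OfK_commFactor (G := fun p κ u => (sf * sm)⁻¹ • unitS sf sm (fun κ u => cH'⁻¹ • ((((1 : ℝ) + 1) / 2) •
      (comp (S κ u) (X p) - comp (X p) (S κ u)) + (((1 : ℝ) - 1) / 2) • R'' p κ u)) κ u) hN hK hδK hSu hδS hG'' hgB hgW
  have hA := letterRow_active_e3OfK_commFactor (G := fun p κ u => (sf * sm)⁻¹ • unitS sf sm (fun κ u => cH'⁻¹ • ((((1 : ℝ) + 1) / 2) •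
      (comp (S κ u) (X p) - comp (X p) (S κ u)) + (((1 : ℝ) - 1) / 2) • R p κ u)) κ u) hN hK hδK hSu hδS hG hgB hgW
  have hA'' := letterRow_active_e3OfK_commFactor (G := fun p κ u => (sf * sm)⁻¹ • unitS sf sm (fun κ u => cH'⁻¹ • ((((1 : ℝ) + 1) / 2) •
      (comp (S κ u) (X p) - comp (X p) (S κ u)) + (((1 : ℝ) - 1) / 2) • R'' p κ u)) κ u) hN hK hδK hSu hδS hG'' hgB hgW
  constructor
  · intro ι p κ' u' x z a b
    have h1 := hP ι p κ' u' x z a b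
    have h2 := hP'' ι p κ' u' x z a b
    dsimp only at h1 h2 ⊢
    rw [Pi.smul_apply, Pi.smul_apply, Pi.smul_apply, Pi.smul_apply, smul_eq_mul, Pi.add_apply, Pi.add_apply, Pi.add_apply, Pi.add_apply, abs_mul]
    rw [mul_assoc (|cout|), mul_assoc (|cout|), add_mul, add_mul]
    exact mul_le_mul_of_nonneg_left ((abs_add_le _ _).trans (add_le_add h1 h2)) (abs_nonneg _)
  · intro κ u ι p x z a b
    have h1 := hA κ u ι p x z a b
    have h2 := hA'' κ u ι p x z a b
    dsimp only at h1 h2 ⊢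
    rw [Pi.smul_apply, Pi.smul_apply, Pi.smul_apply, Pi.smul_apply, smul_eq_mul, Pi.add_apply, Pi.add_apply, Pi.add_apply, Pi.add_apply, abs_mul]
    rw [mul_assoc (|cout|), mul_assoc (|cout|), add_mul, add_mul]
    exact mul_le_mul_of_nonneg_left ((abs_add_le _ _).trans (add_le_add h1 h2)) (abs_nonneg _)

end Even

end Summit.QuantumFields.BalabanUV.Beta.GAN24.SlavedSummandLetterRows

end
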